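import Mathlib
import HarnessLib
import Summits.HodgeConjecture.HodgeConjecture.Theses.NikulinTwinTransport
import Literature.AlgebraicGeometry.Surfaces.K3TwistorLines
import Literature.Geometry.Hyperkaehler.Hyperholomorphic

/-!
# Sketch — first lemmas of the three crux ideas for `TwinTwistorTransport`
(stmt-HodgeConjecture-14522), ideator 1, round 1. Statements only (they must elaborate; proofs are
not the point here). Namespaced away from the route file.
-/

noncomputable section

namespace Summit.HodgeConjecture.HodgeConjecture.Cruxes.TwinTwistorTransport.Sketch

open Literature.AlgebraicGeometry.Surfaces

/-! ## Card `one-line-totally-real-reach` — first lemma -/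

/-- The real K3 form on `Λ_ℝ = K3Index → ℝ` (as in `K3TwistorLines`). -/
def k3RForm : LinearMap.BilinForm ℝ (K3Index → ℝ) :=
  Matrix.toBilin' (k3Gram.map (Int.cast : ℤ → ℝ))

/-- Real part of a period vector. -/
def reVec (σ : K3Index → ℂ) : K3Index → ℝ := fun i => (σ i).re

/-- Imaginary part of a period vector. -/
def imVec (σ : K3Index → ℂ) : K3Index → ℝ := fun i => (σ i).im

/-- The vector `u₀ = (b.h) a − (a.h) b ∈ P_σ ∩ h^⊥` (`a = Re σ`, `b = Im σ`). -/
def reachAxis (σ : K3Index → ℂ) (h : K3Index → ℤ) : K3Index → ℝ :=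
  (k3RForm (imVec σ) (fun i => (h i : ℝ))) • reVec σ - (k3RForm (reVec σ) (fun i => (h i : ℝ))) • imVec σ

/-- The candidate endpoint `x = u₀ + i v`. -/
def reachPoint (σ : K3Index → ℂ) (h : K3Index → ℤ) (v : K3Index → ℝ) : K3Index → ℂ :=
  fun i => ((reachAxis σ h i : ℝ) : ℂ) + ((v i : ℝ) : ℂ) * Complex.I

/-- **One-line reach (first lemma of card `one-line-totally-real-reach`).** From the anchor period
`σ` and a lattice class `h`, every real vector `v` with `v ⊥ u₀`, `v ⊥ h`, `v² = u₀²` and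
`⟨Re σ, Im σ, v⟩` a positive three-space gives a period `x = u₀ + iv` in the period domain,
orthogonal to `h` (so `h` is algebraic on the K3 with period `x`), lying on the SAME twistor line
`T_{⟨Re σ, Im σ, v⟩}` as `σ`. The set of such `x` is a copy of hyperbolic 19-space, a maximal
totally real submanifold of `D ∩ h^⊥`. -/
def OneLineReach : Prop :=
  ∀ σ : K3Index → ℂ, σ ∈ k3PeriodDomain → ∀ (h : K3Index → ℤ) (v : K3Index → ℝ),
    k3RForm (reachAxis σ h) v = 0 →
    k3RForm (fun i => (h i : ℝ)) v = 0 →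
    k3RForm v v = k3RForm (reachAxis σ h) (reachAxis σ h) →
    reachAxis σ h ≠ 0 →
    IsPositiveThreeSpace (Submodule.span ℝ {reVec σ, imVec σ, v}) →
      reachPoint σ h v ∈ k3PeriodDomain ∧
      k3Form (fun i => (h i : ℂ)) (reachPoint σ h v) = 0 ∧
      σ ∈ k3TwistorLine (Submodule.span ℝ {reVec σ, imVec σ, v}) ∧
      reachPoint σ h v ∈ k3TwistorLine (Submodule.span ℝ {reVec σ, imVec σ, v})

/-! ## Card `instanton-moduli-trianalytic-twin` — first lemma (pointwise germ of E3) -/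

open scoped Manifold in
open Literature.Geometry.Hyperkaehler in
/-- **Mixed curvature of an `SU(2)`-invariant 2-covector is quaternion-skew (first lemma of card
`instanton-moduli-trianalytic-twin`).** On a manifold modelled on a product `E₁ × E₂` of complex
normed spaces, with fields `J, K` on the tangent spaces (`= E₁ × E₂`) such that every induced
`L = aI + bJ + cK`, `(a,b,c) ∈ S²`, squares to `−1` at `x`, an `SU(2)`-invariant `W`-valued
2-covector `β` satisfies `β(L p, q) = −β(p, L q)`; in particular its MIXED part
`κ(w)(v) := β((v,0),(0,w))` intertwines `L` on the second factor with the dual quaternionic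
structure `φ ↦ −φ ∘ L` on `Hom(E₁, W)` — the infinitesimal statement that the classifying map of a
hyperholomorphic family on `X × Y′` is tri-holomorphic into the moduli of instantons on `X`. -/
def MixedPartQuaternionSkew : Prop :=
  ∀ (E₁ E₂ W : Type) [NormedAddCommGroup E₁] [NormedSpace ℂ E₁] [NormedAddCommGroup E₂]
    [NormedSpace ℂ E₂] [NormedAddCommGroup W] [NormedSpace ℝ W]
    (M : Type) [TopologicalSpace M] [ChartedSpace (E₁ × E₂) M]
    (J K : ∀ x : M, TangentSpace 𝓘(ℝ, E₁ × E₂) x →L[ℝ] TangentSpace 𝓘(ℝ, E₁ × E₂) x) (x : M)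
    (β : TangentSpace 𝓘(ℝ, E₁ × E₂) x [⋀^Fin 2]→L[ℝ] W),
    (∀ a b c : ℝ, a ^ 2 + b ^ 2 + c ^ 2 = 1 → ∀ u : TangentSpace 𝓘(ℝ, E₁ × E₂) x,
        inducedJ J K a b c x (inducedJ J K a b c x u) = -u) →
    IsSU2InvariantAt J K x β →
    ∀ a b c : ℝ, a ^ 2 + b ^ 2 + c ^ 2 = 1 → ∀ (v : E₁) (w : E₂),
      β ![inducedJ J K a b c x ((v, 0) : E₁ × E₂), ((0, w) : E₁ × E₂)] =
        -β ![((v, 0) : E₁ × E₂), inducedJ J K a b c x ((0, w) : E₁ × E₂)]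

/-! ## Card `semiregular-twin-hodge-locus` — first lemma (globalisation step) -/

/-- **Baire spreading (first lemma of card `semiregular-twin-hodge-locus`).** In a Baire space,
if countably many closed sets, each of which is either everything or has empty interior (the
analytic-topology shadow of "proper Zariski-closed subset of an irreducible variety"), cover a
non-empty open set, then one of them is everything. Applied to the algebraicity locus of
`graph Ψ` (a countable union of images of proper relative Chow schemes) inside the irreducible
polarised twin locus, with the open set supplied by semiregular deformation of the anchor
carrier. -/
def BaireSpread : Prop :=
  ∀ (X : Type) [TopologicalSpace X] [BaireSpace X] (C : ℕ → Set X) (U : Set X),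
    (∀ n, IsClosed (C n)) → (∀ n, C n = Set.univ ∨ interior (C n) = ∅) →
    IsOpen U → U.Nonempty → U ⊆ ⋃ n, C n → ∃ n, C n = Set.univ

end Summit.HodgeConjecture.HodgeConjecture.Cruxes.TwinTwistorTransport.Sketch
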